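import Summits.AtomisticToContinuum.Crystallization.Theses.ChessboardParticlePlanes
import Literature.MathematicalPhysics.StatisticalMechanics.LocalLimitOfGroundStates
import Literature.MathematicalPhysics.StatisticalMechanics.LocalMatchingCompactness
import Literature.MathematicalPhysics.StatisticalMechanics.LennardJonesClusters

/-!
# Crux `PeriodicWindows` (stmt-AtomisticToContinuum-3240), line `Sketch` — stub `stub_laminarLimit`

Step S1 of the lead skeleton `PeriodicWindowsSketch` (pure compactness): from laminar,
`7/10`-separated, `ρ₀`-dense windows of every size (frequently in `N`, up to a linear isometry)
we extract a `ρ₀`-dense, exactly laminar, `7/10`-separated point `X` of the ROTATED hull of the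
Lennard-Jones ground-state sequence `x`.

Proof. Diagonal choice `(η, L) = (1/(k+1), L k)` with `L k ≥ L₀ (1/(k+1))` and
`L k ≥ k + ρ₀ + 1`, realised along a strictly increasing `σ` by
`Filter.extraction_forall_of_frequently`; the rotated recentred configurations
`y k j = A_k (x j - x (i k))` are `δ`-separated by `LennardJonesMinimalDistance_holds`;
`exists_subseq_forall_eventually_ballMatch` extracts a locally convergent subsequence `φ` with a
`δ`-separated limit `X`; laminarity, `7/10`-separation and `ρ₀`-density pass to the limit through
the two-way matching `BallMatch`.
-/

noncomputable section

namespace Summit.AtomisticToContinuum.Crystallization.Theorems.PeriodicWindowsSketch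

open Literature.MathematicalPhysics.StatisticalMechanics Filter

/-- Coordinates are `1`-Lipschitz: `|p l - q l| ≤ dist p q` in `ℝ³`. -/
private theorem abs_sub_apply_le_dist (p q : EuclideanSpace ℝ (Fin 3)) (l : Fin 3) :
    |p l - q l| ≤ dist p q := by
  rw [← Real.dist_eq]
  exact PiLp.dist_apply_le p q l

/-- STUB S1 (compactness only): from laminar windows at every scale, a dense, exactly laminar,
`7/10`-separated point of the ROTATED hull of `x` (diagonal over `(η, L) = (1/(k+1), L k)`,
`δ`-separation of ground states by `LennardJonesMinimalDistance_holds`,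
`exists_subseq_forall_eventually_ballMatch`; laminarity, separation and density pass to the
limit). -/
theorem stub_laminarLimit (ρ₀ : ℝ) (hρ₀ : 0 < ρ₀)
    (x : (N : ℕ) → (Fin N → EuclideanSpace ℝ (Fin 3)))
    (hx : ∀ N, IsGroundState lennardJones (x N))
    (hwin : ∀ η : ℝ, 0 < η → ∃ L₀ : ℝ, ∀ L : ℝ, L₀ ≤ L → ∃ᶠ N in Filter.atTop,
      ∃ (i : Fin N) (A : EuclideanSpace ℝ (Fin 3) →ₗᵢ[ℝ] EuclideanSpace ℝ (Fin 3)) (T : Set ℝ),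
        (∀ t ∈ T, ∀ t' ∈ T, t ≠ t' → (3 : ℝ) / 4 ≤ |t - t'|) ∧
        (∀ j k : Fin N, j ≠ k → dist (x N j) (x N i) ≤ L → dist (x N k) (x N i) ≤ L →
          (7 : ℝ) / 10 ≤ dist (x N j) (x N k)) ∧
        (∀ j : Fin N, dist (x N j) (x N i) ≤ L → ∃ t ∈ T, |(A (x N j - x N i)) 2 - t| ≤ η) ∧
        (∀ c : EuclideanSpace ℝ (Fin 3), dist c (x N i) ≤ L - ρ₀ →
          ∃ j : Fin N, dist (x N j) c ≤ ρ₀)) :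
    ∃ X : Set (EuclideanSpace ℝ (Fin 3)),
      (∃ (σ : ℕ → ℕ) (τ : ℕ → EuclideanSpace ℝ (Fin 3))
          (A : ℕ → (EuclideanSpace ℝ (Fin 3) ≃ₗᵢ[ℝ] EuclideanSpace ℝ (Fin 3))),
        StrictMono σ ∧ ∀ R ε : ℝ, 0 < ε → ∀ᶠ j in Filter.atTop,
          BallMatch ε R 0 (Set.range fun i => A j (x (σ j) i) + τ j) X) ∧
      (∀ c : EuclideanSpace ℝ (Fin 3), ∃ p ∈ X, dist p c ≤ ρ₀) ∧
      (∀ p ∈ X, ∀ q ∈ X, p 2 ≠ q 2 → (3 : ℝ) / 4 ≤ |p 2 - q 2|) ∧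
      (∀ p ∈ X, ∀ q ∈ X, p ≠ q → (7 : ℝ) / 10 ≤ dist p q) := by
  classical
  -- Step 1: uniform minimal distance of Lennard-Jones ground states.
  obtain ⟨δ, hδ, hsepGS⟩ := LennardJonesMinimalDistance_holds
  -- Step 2: diagonal data `(η, L) = (1/(k+1), L k)` along a strictly increasing `σ`.
  have hηpos : ∀ k : ℕ, (0 : ℝ) < 1 / ((k : ℝ) + 1) := fun k => by positivity
  choose L₀ hL₀ using fun k : ℕ => hwin (1 / ((k : ℝ) + 1)) (hηpos k)
  obtain ⟨L, hLL₀, hLk⟩ : ∃ L : ℕ → ℝ, (∀ k, L₀ k ≤ L k) ∧ ∀ k : ℕ, (k : ℝ) + ρ₀ + 1 ≤ L k :=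
    ⟨fun k => max (L₀ k) ((k : ℝ) + ρ₀ + 1), fun k => le_max_left _ _, fun k => le_max_right _ _⟩
  obtain ⟨σ, hσ, hσP⟩ := extraction_forall_of_frequently fun k => hL₀ k (L k) (hLL₀ k)
  choose i A T hT hsepW hlamW hdenW using hσP
  -- Step 3: rotated recentred configurations `y k j = A k (x (σ k) j - x (σ k) (i k))`.
  obtain ⟨A', hA'⟩ : ∃ A' : ℕ → (EuclideanSpace ℝ (Fin 3) ≃ₗᵢ[ℝ] EuclideanSpace ℝ (Fin 3)),
      ∀ k v, A' k v = A k v :=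
    ⟨fun k => (A k).toLinearIsometryEquiv rfl, fun k v => rfl⟩
  obtain ⟨τ, hτ⟩ : ∃ τ : ℕ → EuclideanSpace ℝ (Fin 3), ∀ k, τ k = -(A' k (x (σ k) (i k))) :=
    ⟨_, fun _ => rfl⟩
  obtain ⟨y, hy⟩ : ∃ y : (k : ℕ) → Fin (σ k) → EuclideanSpace ℝ (Fin 3),
      ∀ k j, y k j = A' k (x (σ k) j) + τ k := ⟨_, fun _ _ => rfl⟩
  have hyA : ∀ k j, y k j = A k (x (σ k) j - x (σ k) (i k)) := by
    intro k j
    rw [hy, hτ, hA', hA', LinearIsometry.map_sub, sub_eq_add_neg]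
  have hdist : ∀ k j j', dist (y k j) (y k j') = dist (x (σ k) j) (x (σ k) j') := by
    intro k j j'
    rw [hy, hy, dist_add_right, LinearIsometryEquiv.dist_map]
  have hnorm : ∀ k j, ‖y k j‖ = dist (x (σ k) j) (x (σ k) (i k)) := by
    intro k j
    rw [hyA, LinearIsometry.norm_map, dist_eq_norm]
  have hlamY : ∀ k j, dist (x (σ k) j) (x (σ k) (i k)) ≤ L k →
      ∃ t ∈ T k, |y k j 2 - t| ≤ 1 / ((k : ℝ) + 1) := by
    intro k j h
    rw [hyA]
    exact hlamW k j h
  have hYsep : ∀ k, ∀ p ∈ Set.range (y k), ∀ q ∈ Set.range (y k), p ≠ q → δ ≤ dist p q := by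
    rintro k p ⟨j, rfl⟩ q ⟨j', rfl⟩ hpq
    rw [hdist]
    exact hsepGS (σ k) (x (σ k)) (hx (σ k)) j j' fun h => hpq (by rw [h])
  -- Step 4: sequential compactness in the local matching topology.
  obtain ⟨φ, X, hφ, hXsep, hmatch⟩ :=
    exists_subseq_forall_eventually_ballMatch hδ (fun k => Set.range (y k)) hYsep
  replace hmatch : ∀ R ε : ℝ, 0 < ε → ∀ᶠ k in atTop,
      BallMatch ε R 0 (Set.range (y (φ k))) X := hmatch
  -- growth of the radii and decay of the flatness defect along `φ`
  have hLev : ∀ M : ℝ, ∀ᶠ k in atTop, M ≤ L (φ k) - ρ₀ := by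
    intro M
    refine (tendsto_natCast_atTop_atTop.eventually_ge_atTop M).mono fun k hk => ?_
    have h1 := hLk (φ k)
    have h2 : (k : ℝ) ≤ (φ k : ℝ) := Nat.cast_le.2 hφ.le_apply
    linarith
  have hηev : ∀ ε : ℝ, 0 < ε → ∀ᶠ k in atTop, 1 / ((φ k : ℝ) + 1) ≤ ε := by
    intro ε hε
    refine (tendsto_natCast_atTop_atTop.eventually_ge_atTop (1 / ε)).mono fun k hk => ?_
    have h2 : (k : ℝ) ≤ (φ k : ℝ) := Nat.cast_le.2 hφ.le_apply
    have h3 : (k : ℝ) * ε ≤ (φ k : ℝ) * ε := mul_le_mul_of_nonneg_right h2 hε.le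
    rw [div_le_iff₀ hε] at hk
    rw [div_le_iff₀ (by positivity : (0 : ℝ) < (φ k : ℝ) + 1)]
    linarith
  -- a particle matched to a point of norm `≤ R` lies in the window of radius `L`
  have hwin_mem : ∀ (k : ℕ) (j : Fin (σ k)) (p : EuclideanSpace ℝ (Fin 3)) (R ε : ℝ),
      dist (y k j) p ≤ ε → ‖p‖ ≤ R → R + ε ≤ L k - ρ₀ →
        dist (x (σ k) j) (x (σ k) (i k)) ≤ L k := by
    intro k j p R ε hjp hpR hRL
    rw [← hnorm]
    calc ‖y k j‖ = dist (y k j) 0 := (dist_zero_right _).symm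
      _ ≤ dist (y k j) p + dist p 0 := dist_triangle _ _ _
      _ = dist (y k j) p + ‖p‖ := by rw [dist_zero_right]
      _ ≤ L k := by linarith
  -- Conjunct 4: `7/10`-separation of the limit.
  have hsep : ∀ p ∈ X, ∀ q ∈ X, p ≠ q → (7 : ℝ) / 10 ≤ dist p q := by
    intro p hp q hq hpq
    have hpq0 : 0 < dist p q := dist_pos.2 hpq
    refine le_of_forall_pos_lt_add fun ζ hζ => ?_
    obtain ⟨ε, hε0, hεζ, hεpq⟩ : ∃ ε : ℝ, 0 < ε ∧ ε ≤ ζ / 4 ∧ ε ≤ dist p q / 4 :=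
      ⟨min (ζ / 4) (dist p q / 4), lt_min (by linarith) (by linarith), min_le_left _ _,
        min_le_right _ _⟩
    obtain ⟨k, hB, hkL⟩ :=
      ((hmatch (max ‖p‖ ‖q‖) ε hε0).and (hLev (max ‖p‖ ‖q‖ + ε))).exists
    obtain ⟨a, ⟨j, rfl⟩, hap⟩ :=
      hB.1 p hp (by rw [dist_zero_right]; exact le_max_left _ _)
    obtain ⟨b, ⟨j', rfl⟩, hbq⟩ :=
      hB.1 q hq (by rw [dist_zero_right]; exact le_max_right _ _)
    by_cases hjj' : j = j'
    · subst hjj'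
      have : dist p q ≤ 2 * ε :=
        calc dist p q ≤ dist (y (φ k) j) p + dist (y (φ k) j) q := dist_triangle_left _ _ _
          _ ≤ ε + ε := add_le_add hap hbq
          _ = 2 * ε := by ring
      linarith
    · have h7 := hsepW (φ k) j j' hjj'
        (hwin_mem (φ k) j p _ ε hap (le_max_left _ _) hkL)
        (hwin_mem (φ k) j' q _ ε hbq (le_max_right _ _) hkL)
      rw [← hdist] at h7
      have : dist (y (φ k) j) (y (φ k) j') ≤ dist p q + 2 * ε :=
        calc dist (y (φ k) j) (y (φ k) j')
            ≤ dist (y (φ k) j) p + dist p (y (φ k) j') := dist_triangle _ _ _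
          _ ≤ dist (y (φ k) j) p + (dist p q + dist (y (φ k) j') q) :=
            add_le_add le_rfl (dist_triangle_right _ _ _)
          _ ≤ ε + (dist p q + ε) := add_le_add hap (add_le_add le_rfl hbq)
          _ = dist p q + 2 * ε := by ring
      linarith
  -- Conjunct 3: exact laminarity of the limit.
  have hlam : ∀ p ∈ X, ∀ q ∈ X, p 2 ≠ q 2 → (3 : ℝ) / 4 ≤ |p 2 - q 2| := by
    intro p hp q hq hpq
    by_contra hlt
    rw [not_le] at hlt
    have hd0 : 0 < |p 2 - q 2| := abs_pos.2 (sub_ne_zero.2 hpq)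
    obtain ⟨ε, hε0, hε1, hε2⟩ : ∃ ε : ℝ, 0 < ε ∧ ε ≤ |p 2 - q 2| / 8 ∧
        ε ≤ (3 / 4 - |p 2 - q 2|) / 8 :=
      ⟨min (|p 2 - q 2| / 8) ((3 / 4 - |p 2 - q 2|) / 8), lt_min (by linarith) (by linarith),
        min_le_left _ _, min_le_right _ _⟩
    obtain ⟨k, ⟨hB, hkL⟩, hkη⟩ :=
      (((hmatch (max ‖p‖ ‖q‖) ε hε0).and (hLev (max ‖p‖ ‖q‖ + ε))).and (hηev ε hε0)).exists
    obtain ⟨a, ⟨j, rfl⟩, hap⟩ :=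
      hB.1 p hp (by rw [dist_zero_right]; exact le_max_left _ _)
    obtain ⟨b, ⟨j', rfl⟩, hbq⟩ :=
      hB.1 q hq (by rw [dist_zero_right]; exact le_max_right _ _)
    obtain ⟨t, ht, hjt⟩ :=
      hlamY (φ k) j (hwin_mem (φ k) j p _ ε hap (le_max_left _ _) hkL)
    obtain ⟨t', ht', hj't'⟩ :=
      hlamY (φ k) j' (hwin_mem (φ k) j' q _ ε hbq (le_max_right _ _) hkL)
    have h1 := abs_le.1 (hjt.trans hkη)
    have h2 := abs_le.1 (hj't'.trans hkη)
    have h3 := abs_le.1 ((abs_sub_apply_le_dist (y (φ k) j) p 2).trans hap)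
    have h4 := abs_le.1 ((abs_sub_apply_le_dist (y (φ k) j') q 2).trans hbq)
    by_cases htt' : t = t'
    · subst htt'
      have : |p 2 - q 2| ≤ 4 * ε := abs_sub_le_iff.2 ⟨by linarith, by linarith⟩
      linarith
    · have h5 := hT (φ k) t ht t' ht' htt'
      have : |t - t'| ≤ |p 2 - q 2| + 4 * ε :=
        abs_sub_le_iff.2
          ⟨by linarith [le_abs_self (p 2 - q 2)], by linarith [neg_abs_le (p 2 - q 2)]⟩
      linarith
  -- Conjunct 2: `ρ₀`-density of the limit.
  have hden : ∀ c : EuclideanSpace ℝ (Fin 3), ∃ p ∈ X, dist p c ≤ ρ₀ := by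
    intro c
    -- approximate density, through the windows and the matching
    have happrox : ∀ ε : ℝ, 0 < ε → ∃ s ∈ X, dist s c ≤ ρ₀ + ε := by
      intro ε hε
      obtain ⟨k, hB, hkL⟩ := ((hmatch (‖c‖ + ρ₀) ε hε).and (hLev ‖c‖)).exists
      -- pull `c` back to the original coordinates of the window
      obtain ⟨c', hc'c⟩ : ∃ c' : EuclideanSpace ℝ (Fin 3), A' (φ k) c' + τ (φ k) = c :=
        ⟨(A' (φ k)).symm (c - τ (φ k)), by
          rw [LinearIsometryEquiv.apply_symm_apply, sub_add_cancel]⟩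
      have hci : dist c' (x (σ (φ k)) (i (φ k))) ≤ L (φ k) - ρ₀ := by
        have h1 : dist c' (x (σ (φ k)) (i (φ k))) =
            dist (A' (φ k) c' + τ (φ k)) (A' (φ k) (x (σ (φ k)) (i (φ k))) + τ (φ k)) := by
          rw [dist_add_right, LinearIsometryEquiv.dist_map]
        rw [h1, hc'c, hτ, add_neg_cancel, dist_zero_right]
        exact hkL
      obtain ⟨j, hj⟩ := hdenW (φ k) c' hci
      have hjc : dist (y (φ k) j) c ≤ ρ₀ := by
        rw [hy, ← hc'c, dist_add_right, LinearIsometryEquiv.dist_map]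
        exact hj
      have hjR : dist (y (φ k) j) 0 ≤ ‖c‖ + ρ₀ :=
        calc dist (y (φ k) j) 0 ≤ dist (y (φ k) j) c + dist c 0 := dist_triangle _ _ _
          _ ≤ ρ₀ + ‖c‖ := add_le_add hjc (dist_zero_right c).le
          _ = ‖c‖ + ρ₀ := add_comm _ _
      obtain ⟨s, hs, hjs⟩ := hB.2 (y (φ k) j) (Set.mem_range_self j) hjR
      refine ⟨s, hs, ?_⟩
      calc dist s c ≤ dist (y (φ k) j) s + dist (y (φ k) j) c := dist_triangle_left _ _ _
        _ ≤ ε + ρ₀ := add_le_add hjs hjc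
        _ = ρ₀ + ε := add_comm _ _
    -- the finitely many points of `X` near `c` contain a closest one
    have hfin : (X ∩ Metric.closedBall c (ρ₀ + 1)).Finite :=
      finite_of_forall_le_dist_of_subset_closedBall hδ
        (fun p hp q hq hpq => hXsep p hp.1 q hq.1 hpq) Set.inter_subset_right
    obtain ⟨s₁, hs₁, hs₁c⟩ := happrox 1 one_pos
    have hne : (X ∩ Metric.closedBall c (ρ₀ + 1)).Nonempty :=
      ⟨s₁, hs₁, Metric.mem_closedBall.2 hs₁c⟩
    obtain ⟨s₀, hs₀, hmin⟩ := Set.exists_min_image _ (fun s => dist s c) hfin hne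
    refine ⟨s₀, hs₀.1, le_of_forall_pos_le_add fun ε hε => ?_⟩
    obtain ⟨s, hs, hsc⟩ := happrox (min ε 1) (lt_min hε one_pos)
    have hsS : s ∈ X ∩ Metric.closedBall c (ρ₀ + 1) :=
      ⟨hs, Metric.mem_closedBall.2 (hsc.trans (by linarith [min_le_right ε 1]))⟩
    calc dist s₀ c ≤ dist s c := hmin s hsS
      _ ≤ ρ₀ + min ε 1 := hsc
      _ ≤ ρ₀ + ε := by linarith [min_le_left ε 1]
  -- Conjunct 1: `X` is a point of the rotated hull of `x`, and assembly.
  have hYeq : ∀ k, (Set.range fun j => A' k (x (σ k) j) + τ k) = Set.range (y k) :=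
    fun k => congrArg Set.range (funext fun j => (hy k j).symm)
  refine ⟨X, ⟨fun k => σ (φ k), fun k => τ (φ k), fun k => A' (φ k), fun a b hab => hσ (hφ hab),
    fun R ε hε => ?_⟩, hden, hlam, hsep⟩
  refine (hmatch R ε hε).mono fun k hk => ?_
  show BallMatch ε R 0 (Set.range fun j => A' (φ k) (x (σ (φ k)) j) + τ (φ k)) X
  rw [hYeq]
  exact hk

end Summit.AtomisticToContinuum.Crystallization.Theorems.PeriodicWindowsSketch

end
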